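import Summits.NavierStokesRegularity.NavierStokesRegularity.Theorems.TypeILiouvilleTypeIliouvilleNoTypeIIEternalEnergyLiouvilleZeroSliceLimit
import Literature.Analysis.FluidPDE.OseenMildUniqueness
import Literature.Analysis.UnboundedOperators.HeatKernelHeatEquation
import HarnessLib

/-!
# Quiescent epochs: the zero flow on `[0, ∞) × ℝ³` is an α-limit of every EEL′-class profile (crux
# `TypeIliouvilleNoTypeII`, stmt-NavierStokesRegularity-0056; rigidity residual EEL′ of the
# pressure-free eternal split)

Helper file (theorems only).  `exists_alphaLimit_zeroSlice` (p488704) produced, for every bounded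
eternal Oseen-mild smooth divergence-free `v` with `A_ess, C, E ≤ I < ∞` on all parabolic balls, times
`τ_j → -∞` and a limit `W` of the translates `v(· + τ_j, ·)` in the same class with `W(0, ·) ≡ 0`.
Forward uniqueness of bounded solutions of the Oseen integral equation (tree
`oseenMild_bounded_unique`, KNSS §4 / Giga–Inui–Matsui) then kills `W` on the whole forward half-line:

* `eq_zero_forward_of_slice_zero` — a bounded eternal Oseen-mild jointly continuous field with a
  vanishing time slice `W(t₀, ·) ≡ 0` vanishes for all `t ≥ t₀`;
* `exists_alphaLimit_zero_forward` — **every member of the EEL′ class has the ZERO FLOW on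
  `[0, ∞) × ℝ³` as an α-limit**: `v(t + τ_j, y) → 0` for all `t ≥ 0`, `y`, along some `τ_j → -∞`.

For the residual core of EEL′ (extremal profiles, `|v(0,0)| = sup |v| > 0`): arbitrarily far in the
past the profile passes through arbitrarily long, arbitrarily wide epochs of (pointwise) quiescence
before bursting to its maximum — the open Liouville content of EEL′ is a statement about the
IGNITION of such bursts from rest.  WHAT THIS IS NOT: not NS; EEL′ stays OPEN. [folklore]
-/

noncomputable section

-- the summit and its single problem share the name `NavierStokesRegularity` (D-0017 nested layout)
set_option linter.dupNamespace false

open Set Function Filter Topology MeasureTheory Metric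
open scoped NNReal ENNReal

namespace Summit.NavierStokesRegularity.NavierStokesRegularity.Theorems.TypeIliouvilleNoTypeII.TypeIIZoom

open Literature.Analysis Literature.Analysis.FluidPDE

variable {v : ℝ → EuclideanSpace ℝ (Fin 3) → EuclideanSpace ℝ (Fin 3)}

/-- **Forward uniqueness from a zero slice.**  A bounded, jointly continuous field on `ℝ × ℝ³`
solving the Oseen integral equation `W(t) = e^{(t-s)Δ}W(s) - B¹_s(W,W)(t)` between all `s < t`, with
`W(t₀, ·) ≡ 0`, vanishes for all `t ≥ t₀` (the zero field solves the same equation from the same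
slice; `oseenMild_bounded_unique`). [cite: KochNadirashviliSereginSverak2009, §4 (4.3)–(4.4) (arXiv:0709.3599 p. 8)] -/
theorem eq_zero_forward_of_slice_zero {W : ℝ → EuclideanSpace ℝ (Fin 3) → EuclideanSpace ℝ (Fin 3)}
    (hcont : Continuous (uncurry W)) {N : ℝ} (hbd : ∀ (t : ℝ) (x : EuclideanSpace ℝ (Fin 3)), ‖W t x‖ ≤ N)
    (hmild : ∀ s t : ℝ, s < t → ∀ x, W t x = heatFlow (W s) (t - s) x - oseenDuhamel 1 s W W t x)
    {t₀ : ℝ} (h0 : ∀ y, W t₀ y = 0) {t : ℝ} (ht : t₀ ≤ t) (y : EuclideanSpace ℝ (Fin 3)) :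
    W t y = 0 := by
  rcases eq_or_lt_of_le ht with rfl | hlt
  · exact h0 y
  have hN : 0 ≤ N := (norm_nonneg _).trans (hbd 0 0)
  have hW0 : W t₀ = fun _ => (0 : EuclideanSpace ℝ (Fin 3)) := funext h0
  -- on the window `(t₀, t + 1)` both `W` and `0` solve the Oseen equation with free term `0`
  set T : ℝ := t + 1 with hT
  have hfree : ∀ τ ∈ Ioo t₀ T, ∀ x, heatFlow (W t₀) (τ - t₀) x = 0 := by
    intro τ hτ x
    rw [hW0, heatFlow_of_pos _ (sub_pos.2 hτ.1), UnboundedOperators.heatExtension_zero_fun]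
    rfl
  have hWm : AEStronglyMeasurable (uncurry W)
      ((volume : Measure (ℝ × EuclideanSpace ℝ (Fin 3))).restrict (Ioo t₀ T ×ˢ univ)) :=
    hcont.aestronglyMeasurable.restrict
  have h0m : AEStronglyMeasurable (uncurry fun (_ : ℝ) (_ : EuclideanSpace ℝ (Fin 3)) =>
      (0 : EuclideanSpace ℝ (Fin 3)))
      ((volume : Measure (ℝ × EuclideanSpace ℝ (Fin 3))).restrict (Ioo t₀ T ×ˢ univ)) :=
    aestronglyMeasurable_const
  have hWeq : ∀ τ ∈ Ioo t₀ T, W τ =ᵐ[volume]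
      fun x => (fun (_ : ℝ) (_ : EuclideanSpace ℝ (Fin 3)) => (0 : EuclideanSpace ℝ (Fin 3))) τ x -
        oseenDuhamel 1 t₀ W W τ x := by
    intro τ hτ
    refine Eventually.of_forall fun x => ?_
    rw [hmild t₀ τ hτ.1 x, hfree τ hτ x]
  have h0eq : ∀ τ ∈ Ioo t₀ T,
      (fun (_ : ℝ) (_ : EuclideanSpace ℝ (Fin 3)) => (0 : EuclideanSpace ℝ (Fin 3))) τ =ᵐ[volume]
      fun x => (fun (_ : ℝ) (_ : EuclideanSpace ℝ (Fin 3)) => (0 : EuclideanSpace ℝ (Fin 3))) τ x -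
        oseenDuhamel 1 t₀ (fun (_ : ℝ) (_ : EuclideanSpace ℝ (Fin 3)) => (0 : EuclideanSpace ℝ (Fin 3)))
          (fun (_ : ℝ) (_ : EuclideanSpace ℝ (Fin 3)) => (0 : EuclideanSpace ℝ (Fin 3))) τ x := by
    intro τ _
    refine Eventually.of_forall fun x => ?_
    have h := oseenDuhamel_zero_left 1 t₀
      (fun (_ : ℝ) (_ : EuclideanSpace ℝ (Fin 3)) => (0 : EuclideanSpace ℝ (Fin 3)))
    simp only [show (fun (_ : ℝ) (_ : EuclideanSpace ℝ (Fin 3)) => (0 : EuclideanSpace ℝ (Fin 3))) =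
      (0 : ℝ → EuclideanSpace ℝ (Fin 3) → EuclideanSpace ℝ (Fin 3)) from rfl] at h ⊢
    rw [h]
    simp
  have huniq := oseenMild_bounded_unique (E := EuclideanSpace ℝ (Fin 3)) one_pos hN hWm h0m
    (fun τ _ x => hbd τ x) (fun τ _ x => by simpa using hN) hWeq h0eq t ⟨hlt, by linarith⟩
  -- a.e. zero and continuous ⇒ zero
  have hc : Continuous (W t) := hcont.comp (Continuous.prodMk_right t)
  have h := (hc.ae_eq_iff_eq volume continuous_const).1 huniq
  exact congrFun h y

/-- **The zero flow on `[0, ∞)` is an α-limit.**  Every bounded eternal Oseen-mild smooth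
divergence-free field with `A_ess, C, E ≤ I ≠ ∞` on all parabolic balls admits times `τ_j → -∞` with
`v(t + τ_j, y) → 0` for all `t ≥ 0` and all `y` (and the translates converge at every point of
space-time to a member of the class vanishing on `[0, ∞) × ℝ³`). [folklore] -/
theorem exists_alphaLimit_zero_forward (hv : ContDiff ℝ (⊤ : ℕ∞) (uncurry v))
    (hdiv : ∀ t, VectorCalculus.IsDivFree (v t))
    (hmild : ∀ s t : ℝ, s < t → ∀ x, v t x = heatFlow (v s) (t - s) x - oseenDuhamel 1 s v v t x)
    {N : ℝ} (hbd : ∀ (t : ℝ) (x : EuclideanSpace ℝ (Fin 3)), ‖v t x‖ ≤ N) {I : ℝ≥0∞} (hI : I ≠ ⊤)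
    (hball : ∀ r : ℝ, 0 < r → ∀ z : ℝ × EuclideanSpace ℝ (Fin 3),
      cknAEss r z v ≤ I ∧ cknC r z v ≤ I ∧ cknE r z (fun s y => fderiv ℝ (v s) y) ≤ I) :
    ∃ τ : ℕ → ℝ, Tendsto τ atTop atBot ∧
      ∀ t : ℝ, 0 ≤ t → ∀ y : EuclideanSpace ℝ (Fin 3), Tendsto (fun j => v (t + τ j) y) atTop (𝓝 0) := by
  obtain ⟨τ, W, hτ, hW, -, hWmild, hWbd, -, hWlim, hW0⟩ :=
    exists_alphaLimit_zeroSlice hv hdiv hmild hbd hI hball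
  refine ⟨τ, hτ, fun t ht y => ?_⟩
  have hzero : W t y = 0 := eq_zero_forward_of_slice_zero hW.continuous hWbd hWmild hW0 ht y
  rw [← hzero]
  exact hWlim t y

end Summit.NavierStokesRegularity.NavierStokesRegularity.Theorems.TypeIliouvilleNoTypeII.TypeIIZoom

end
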